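import Literature.NumberTheory.GaloisCohomology.PoitouTateSelmerStructures
import HarnessLib

/-!
# Poitou–Tate, the annihilator of `Ш¹` — part 2/3: at a new place `v₀ ∉ S`, localisation is onto
# `H¹(K_{v₀}, M^D)/H¹_ur` and a functional killing the classes unramified off `S` has an UNRAMIFIED
# representative `t_{v₀} ∈ H¹_ur(K_{v₀}, M)` (Howard Thm. 2.1.11; Milne I Cor. 2.3, Thm. 2.6)

Cell `bsd-wall`, seat `bsd-line-chl-p2` g5 (crux K4 stmt-BirchSwinnertonDyer-24200, stub
`stub_poitouTateShaTateDual`); see part 1 (`…ShaDualFiniteDuality`) for the programme.  Theorems only.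

Fix a family `inv` of local invariant maps with `UnramifiedOrthogonal` (Milne I Thm. 2.6:
`H¹_ur(K_v, M)^* = H¹_ur(K_v, M^D)`) and `SelmerComplement` (Howard Thm. 2.1.11, both "annihilator ⊆ image"
inclusions for Selmer structures), a finite `n`-torsion `M`, and a finite set of places
`S ⊇ {v ∣ ∞} ∪ {v ∣ n} ∪ Ram(M)` which is LARGE: every class of `H¹(K, M)` unramified off `S` and zero on `S`
is zero at all finite places (`Ш¹_S(M) = Ш¹(M)`; such `S` exist by part 1's
`exists_finset_forall_localization_eq_zero`).  Let `v₀ ∉ S` be a finite place.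

* §1 `exists_localization_sub_mem_unramifiedSubgroup`: **every `u₀ ∈ H¹(K_{v₀}, M^D)` is `loc_{v₀} y` up to
  an unramified class for a global `y ∈ H¹(K, M^D)` unramified off `S ∪ {v₀}`** — Howard's second sequence
  for the Selmer structures `𝓕 =` strict at `S ∪ {v₀}` `≤ 𝓖 =` strict at `S` (both unramified outside):
  `H¹_𝓖(K, M) = Ш¹_S(M) = Ш¹(M)` pairs to zero with every local family, so the annihilation hypothesis of
  (ii) is empty, and `𝓖^*_{v₀} = H¹_ur(K_{v₀}, M)^* = H¹_ur(K_{v₀}, M^D)`.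
* §2 `exists_mem_unramifiedSubgroup_localTatePairingZMod_eq` (also needs `IsPerfect`): **for an additive
  `λ : H¹(K, M^D) → ℤ/n` killing the classes unramified off `S` there is `t₀ ∈ H¹_ur(K_{v₀}, M)` with
  `inv_{v₀}(t₀ ∪ loc_{v₀} y) = λ(y)` for all `y` unramified off `S ∪ {v₀}`** — `λ` factors through
  `H¹(K_{v₀}, M^D)/H¹_ur` by §1, the induced functional is `⟨t₀, ·⟩` by local duality, and `t₀ ⟂ H¹_ur(M^D)`
  forces `t₀ ∈ H¹_ur(M)` (Milne I 2.6).

HONEST FRAMING: infrastructure `--supports stmt-BirchSwinnertonDyer-24200`; closes no item; BSD is not proved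
by any of this.

References: [Howard2004HeegnerKolyvagin] Def. 2.1.6, 2.1.10, Thm. 2.1.11 (arXiv:1202.6340 pp. 5–6);
[MilneADT2006] I Cor. 2.3, Thm. 2.6, Thm. 4.10 (b) and proof.
-/

noncomputable section

open Function NumberField IsDedekindDomain
open scoped NumberField

universe u

set_option linter.dupNamespace false
set_option autoImplicit false

namespace Summit.BirchSwinnertonDyer.BirchSwinnertonDyer.Theorems.PoitouTateShaAnnihilator

open Literature.NumberTheory.GaloisRepresentations
open Literature.NumberTheory.GaloisRepresentations.DiscreteGaloisModule (mu localTatePairingZMod tateDual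
  unramifiedSubgroup SelmerStructure)
open Literature.NumberTheory.GaloisCohomology

/-! ## §1 Surjectivity of localisation onto `H¹(K_{v₀}, M^D)/H¹_ur` at a new place `v₀ ∉ S` -/

section NewPlace

variable {K : Type u} [Field K] [NumberField K] {M : Type u} [AddCommGroup M] [TopologicalSpace M]
  [DiscreteTopology M] [Finite M] {n : ℕ}

/-- **Every local class at a new place is a global class up to an unramified one.** Let the family
`inv` satisfy Milne I Thm. 2.6 (`UnramifiedOrthogonal`) and Poitou–Tate for Selmer structures
(`SelmerComplement`); let `S ⊇ {v ∣ ∞} ∪ {v ∣ n} ∪ Ram(M)` be finite and LARGE in the sense of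
`exists_finset_forall_localization_eq_zero` (`Ш¹_S(M) = Ш¹(M)` at the finite places); let `v₀ ∉ S` be a
finite place. Then for every `u₀ ∈ H¹(K_{v₀}, M^D)` there is a global `y ∈ H¹(K, M^D)`, unramified at
the finite places outside `S ∪ {v₀}`, with `loc_{v₀} y − u₀ ∈ H¹_ur(K_{v₀}, M^D)`: Howard's Thm. 2.1.11
(second sequence) for the Selmer structures `𝓕 = ` strict at `S ∪ {v₀}` ` ≤ 𝓖 = ` strict at `S`, both
unramified outside, whose `H¹_𝓖(K, M) = Ш¹_S(M) = Ш¹(M)` pairs to zero with everything, and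
`𝓖^*_{v₀} = H¹_ur(K_{v₀}, M)^* = H¹_ur(K_{v₀}, M^D)` (Milne I Thm. 2.6).
[cite: Howard2004HeegnerKolyvagin, Thm. 2.1.11 (arXiv:1202.6340 p. 6)] [cite: MilneADT2006, Ch. I, Thm. 2.6] -/
theorem exists_localization_sub_mem_unramifiedSubgroup {inv : LocalInvariants K n}
    (hur : inv.UnramifiedOrthogonal) (hcomp : inv.SelmerComplement)
    (ρ : DiscreteGaloisModule K M) (hM : ∀ m : M, n • m = 0)
    (S : Finset (Place K)) (hinf : ∀ w : InfinitePlace K, (Sum.inl w : Place K) ∈ S)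
    (hS : ∀ v : HeightOneSpectrum (𝓞 K), (Sum.inr v : Place K) ∉ S →
      ((n : ℕ) : 𝓞 K) ∉ v.asIdeal ∧ GaloisRep.IsUnramifiedAt v ρ)
    (hstab : ∀ x : galoisCohomology ρ 1,
      (∀ v : HeightOneSpectrum (𝓞 K), (Sum.inr v : Place K) ∈ S →
        galoisCohomology.localization ρ (Sum.inr v) 1 x = 0) →
      (∀ v : HeightOneSpectrum (𝓞 K), (Sum.inr v : Place K) ∉ S →
        galoisCohomology.localization ρ (Sum.inr v) 1 x ∈ unramifiedSubgroup (GaloisRep.toLocal v ρ) 1) →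
      ∀ v : HeightOneSpectrum (𝓞 K), galoisCohomology.localization ρ (Sum.inr v) 1 x = 0)
    {v₀ : HeightOneSpectrum (𝓞 K)} (hv₀ : (Sum.inr v₀ : Place K) ∉ S)
    (u₀ : galoisCohomology ((ρ.tateDual n).toLocal (Sum.inr v₀)) 1) :
    ∃ y : galoisCohomology (ρ.tateDual n) 1,
      (∀ v : HeightOneSpectrum (𝓞 K), (Sum.inr v : Place K) ∉ S → v ≠ v₀ →
        galoisCohomology.localization (ρ.tateDual n) (Sum.inr v) 1 y ∈
          unramifiedSubgroup (GaloisRep.toLocal v (ρ.tateDual n)) 1) ∧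
      galoisCohomology.localization (ρ.tateDual n) (Sum.inr v₀) 1 y - u₀ ∈
        unramifiedSubgroup (GaloisRep.toLocal v₀ (ρ.tateDual n)) 1 := by
  classical
  -- `S' = S ∪ {v₀}`; `𝓖` = strict at `S`, unramified outside (`𝓖_{v₀} = H¹_ur`); `𝓕` = strict at `S'`
  set S' : Finset (Place K) := insert (Sum.inr v₀) S with hS'def
  let 𝓖 : SelmerStructure ρ := SelmerStructure.ofFinite ρ fun v =>
    if (Sum.inr v : Place K) ∈ S then ⊥ else unramifiedSubgroup (GaloisRep.toLocal v ρ) 1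
  let 𝓕 : SelmerStructure ρ := SelmerStructure.ofFinite ρ fun v =>
    if (Sum.inr v : Place K) ∈ S' then ⊥ else unramifiedSubgroup (GaloisRep.toLocal v ρ) 1
  have hS'S : S ⊆ S' := Finset.subset_insert _ _
  have hv₀S' : (Sum.inr v₀ : Place K) ∈ S' := Finset.mem_insert_self _ _
  have h𝓖bot : ∀ v : HeightOneSpectrum (𝓞 K), (Sum.inr v : Place K) ∈ S → 𝓖 (Sum.inr v) = ⊥ :=
    fun v hv => by simp only [𝓖, SelmerStructure.ofFinite_inr, if_pos hv]; rfl
  have h𝓖ur : ∀ v : HeightOneSpectrum (𝓞 K), (Sum.inr v : Place K) ∉ S →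
      𝓖 (Sum.inr v) = unramifiedSubgroup (GaloisRep.toLocal v ρ) 1 :=
    fun v hv => by simp only [𝓖, SelmerStructure.ofFinite_inr, if_neg hv]
  have h𝓕bot : ∀ v : HeightOneSpectrum (𝓞 K), (Sum.inr v : Place K) ∈ S' → 𝓕 (Sum.inr v) = ⊥ :=
    fun v hv => by simp only [𝓕, SelmerStructure.ofFinite_inr, if_pos hv]; rfl
  have h𝓕ur : ∀ v : HeightOneSpectrum (𝓞 K), (Sum.inr v : Place K) ∉ S' →
      𝓕 (Sum.inr v) = unramifiedSubgroup (GaloisRep.toLocal v ρ) 1 :=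
    fun v hv => by simp only [𝓕, SelmerStructure.ofFinite_inr, if_neg hv]
  have hle : 𝓕 ≤ 𝓖 := by
    intro v
    cases v with
    | inl w => exact le_rfl
    | inr v =>
      by_cases hv : (Sum.inr v : Place K) ∈ S
      · rw [h𝓕bot v (hS'S hv), h𝓖bot v hv]
      · by_cases hv' : (Sum.inr v : Place K) ∈ S'
        · rw [h𝓕bot v hv']; exact bot_le
        · rw [h𝓕ur v hv', h𝓖ur v hv]
  have h𝓕 : 𝓕.IsUnramifiedOutside S' := ⟨fun w => hS'S (hinf w), fun v hv => h𝓕ur v hv⟩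
  have h𝓖 : 𝓖.IsUnramifiedOutside S' :=
    ⟨fun w => hS'S (hinf w), fun v hv => h𝓖ur v fun h => hv (hS'S h)⟩
  have hS'ur : ∀ v : HeightOneSpectrum (𝓞 K), (Sum.inr v : Place K) ∉ S' →
      ((n : ℕ) : 𝓞 K) ∉ v.asIdeal ∧ GaloisRep.IsUnramifiedAt v ρ :=
    fun v hv => hS v fun h => hv (hS'S h)
  -- the test family `u`, supported at `v₀`
  let u : Π v : Place K, galoisCohomology ((ρ.tateDual n).toLocal v) 1 :=
    Function.update (fun _ => 0) (Sum.inr v₀) u₀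
  have hu₀ : u (Sum.inr v₀) = u₀ := Function.update_self _ _ _
  have hu : ∀ v : Place K, v ≠ Sum.inr v₀ → u v = 0 := fun v hv => Function.update_of_ne hv _ _
  -- hypotheses of `SelmerComplement` (ii)
  have huF : ∀ v ∈ S', u v ∈ inv.dualSelmerStructure ρ 𝓕 v := by
    intro v hv
    by_cases hvv : v = Sum.inr v₀
    · subst hvv
      rw [LocalInvariants.dualSelmerStructure_apply, h𝓕bot v₀ hv₀S',
        LocalInvariants.dualLocalCondition_bot]
      exact AddSubgroup.mem_top _
    · rw [hu v hvv]
      exact AddSubgroup.zero_mem _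
  have horth : ∀ x ∈ 𝓖.selmerGroup, ∑ v ∈ S', localTatePairingZMod ρ n v (inv v)
      (galoisCohomology.localization ρ v 1 x) (u v) = 0 := by
    intro x hx
    rw [SelmerStructure.mem_selmerGroup_iff] at hx
    have hx0 : ∀ v : HeightOneSpectrum (𝓞 K), galoisCohomology.localization ρ (Sum.inr v) 1 x = 0 := by
      refine hstab x (fun v hv => ?_) (fun v hv => ?_)
      · have h := hx (Sum.inr v)
        rw [h𝓖bot v hv, AddSubgroup.mem_bot] at h
        exact h
      · have h := hx (Sum.inr v)
        rw [h𝓖ur v hv] at h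
        exact h
    refine Finset.sum_eq_zero fun v _ => ?_
    by_cases hvv : v = Sum.inr v₀
    · subst hvv
      rw [hx0 v₀, map_zero, AddMonoidHom.zero_apply]
    · rw [hu v hvv, map_zero]
  obtain ⟨y, hy, hyu⟩ := (hcomp ρ hM S' hS'ur 𝓕 𝓖 hle h𝓕 h𝓖).2 u huF horth
  refine ⟨y, fun v hv hne => ?_, ?_⟩
  · -- `y ∈ H¹_{𝓕*}(K, M^D)`: at a finite `v ∉ S'`, `𝓕_v = H¹_ur(M)` and `𝓕^*_v = H¹_ur(M^D)`
    have hvS' : (Sum.inr v : Place K) ∉ S' := by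
      rw [hS'def, Finset.mem_insert, not_or]
      exact ⟨fun h => hne (Sum.inr_injective h), hv⟩
    have h := (SelmerStructure.mem_selmerGroup_iff _ y).1 hy (Sum.inr v)
    rw [LocalInvariants.dualSelmerStructure_apply, h𝓕ur v hvS',
      (hur ρ hM v (hS'ur v hvS').1 (hS'ur v hvS').2).1] at h
    exact h
  · have h := hyu (Sum.inr v₀) hv₀S'
    rw [LocalInvariants.dualSelmerStructure_apply, hu₀, h𝓖ur v₀ hv₀,
      (hur ρ hM v₀ (hS v₀ hv₀).1 (hS v₀ hv₀).2).1] at h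
    exact h

end NewPlace

/-! ## §2 The unramified representative `t_{v₀}` at a new place -/

section Representative

variable {K : Type u} [Field K] [NumberField K] {M : Type u} [AddCommGroup M] [TopologicalSpace M]
  [DiscreteTopology M] [Finite M] {n : ℕ}

/-- **The unramified representative at a new place.**  In the situation of
`exists_localization_sub_mem_unramifiedSubgroup` (family `inv` with `IsPerfect`, `UnramifiedOrthogonal`,
`SelmerComplement`; `S` large; `v₀ ∉ S` finite), let `λ : H¹(K, M^D) → ℤ/n` be additive and vanish on every
class unramified off `S`.  Then there is an UNRAMIFIED `t₀ ∈ H¹_ur(K_{v₀}, M)` with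
`inv_{v₀}(t₀ ∪ loc_{v₀} y) = λ(y)` for every `y` unramified off `S ∪ {v₀}`: `λ` restricted to those classes
factors through `H¹(K_{v₀}, M^D)/H¹_ur` (surjectivity of localisation, and `λ` kills the classes with
unramified `v₀`-component), the induced functional on `H¹(K_{v₀}, M^D)` is `⟨t₀, ·⟩_{v₀}` by local Tate
duality, and `t₀` annihilates `H¹_ur(K_{v₀}, M^D)`, hence is unramified (Milne I Thm. 2.6).
[cite: MilneADT2006, Ch. I, Cor. 2.3, Thm. 2.6, Thm. 4.10 (proof)] -/
theorem exists_mem_unramifiedSubgroup_localTatePairingZMod_eq {inv : LocalInvariants K n}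
    (hperf : inv.IsPerfect) (hur : inv.UnramifiedOrthogonal) (hcomp : inv.SelmerComplement)
    (ρ : DiscreteGaloisModule K M) (hM : ∀ m : M, n • m = 0)
    (S : Finset (Place K)) (hinf : ∀ w : InfinitePlace K, (Sum.inl w : Place K) ∈ S)
    (hS : ∀ v : HeightOneSpectrum (𝓞 K), (Sum.inr v : Place K) ∉ S →
      ((n : ℕ) : 𝓞 K) ∉ v.asIdeal ∧ GaloisRep.IsUnramifiedAt v ρ)
    (hstab : ∀ x : galoisCohomology ρ 1,
      (∀ v : HeightOneSpectrum (𝓞 K), (Sum.inr v : Place K) ∈ S →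
        galoisCohomology.localization ρ (Sum.inr v) 1 x = 0) →
      (∀ v : HeightOneSpectrum (𝓞 K), (Sum.inr v : Place K) ∉ S →
        galoisCohomology.localization ρ (Sum.inr v) 1 x ∈ unramifiedSubgroup (GaloisRep.toLocal v ρ) 1) →
      ∀ v : HeightOneSpectrum (𝓞 K), galoisCohomology.localization ρ (Sum.inr v) 1 x = 0)
    (lam : galoisCohomology (ρ.tateDual n) 1 →+ ZMod n)
    (hlam : ∀ y : galoisCohomology (ρ.tateDual n) 1,
      (∀ v : HeightOneSpectrum (𝓞 K), (Sum.inr v : Place K) ∉ S →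
        galoisCohomology.localization (ρ.tateDual n) (Sum.inr v) 1 y ∈
          unramifiedSubgroup (GaloisRep.toLocal v (ρ.tateDual n)) 1) → lam y = 0)
    {v₀ : HeightOneSpectrum (𝓞 K)} (hv₀ : (Sum.inr v₀ : Place K) ∉ S) :
    ∃ t₀ : galoisCohomology (ρ.toLocal (Sum.inr v₀)) 1,
      t₀ ∈ unramifiedSubgroup (GaloisRep.toLocal v₀ ρ) 1 ∧
      ∀ y : galoisCohomology (ρ.tateDual n) 1,
        (∀ v : HeightOneSpectrum (𝓞 K), (Sum.inr v : Place K) ∉ S → v ≠ v₀ →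
          galoisCohomology.localization (ρ.tateDual n) (Sum.inr v) 1 y ∈
            unramifiedSubgroup (GaloisRep.toLocal v (ρ.tateDual n)) 1) →
        localTatePairingZMod ρ n (Sum.inr v₀) (inv (Sum.inr v₀)) t₀
          (galoisCohomology.localization (ρ.tateDual n) (Sum.inr v₀) 1 y) = lam y := by
  classical
  -- the classes unramified off `S ∪ {v₀}`
  let 𝓣' : SelmerStructure (ρ.tateDual n) := SelmerStructure.ofFinite (ρ.tateDual n) fun v =>
    if (Sum.inr v : Place K) ∈ S ∨ v = v₀ then ⊤
    else unramifiedSubgroup (GaloisRep.toLocal v (ρ.tateDual n)) 1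
  have h𝓣'top : ∀ v : HeightOneSpectrum (𝓞 K), ((Sum.inr v : Place K) ∈ S ∨ v = v₀) →
      𝓣' (Sum.inr v) = ⊤ :=
    fun v hv => by simp only [𝓣', SelmerStructure.ofFinite_inr, if_pos hv]; rfl
  have h𝓣'ur : ∀ v : HeightOneSpectrum (𝓞 K), ¬ ((Sum.inr v : Place K) ∈ S ∨ v = v₀) →
      𝓣' (Sum.inr v) = unramifiedSubgroup (GaloisRep.toLocal v (ρ.tateDual n)) 1 :=
    fun v hv => by simp only [𝓣', SelmerStructure.ofFinite_inr, if_neg hv]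
  have hmem𝓣' : ∀ y : galoisCohomology (ρ.tateDual n) 1, y ∈ 𝓣'.selmerGroup ↔
      ∀ v : HeightOneSpectrum (𝓞 K), (Sum.inr v : Place K) ∉ S → v ≠ v₀ →
        galoisCohomology.localization (ρ.tateDual n) (Sum.inr v) 1 y ∈
          unramifiedSubgroup (GaloisRep.toLocal v (ρ.tateDual n)) 1 := by
    intro y
    rw [SelmerStructure.mem_selmerGroup_iff]
    constructor
    · intro h v hv hne
      have h' := h (Sum.inr v)
      rwa [h𝓣'ur v (not_or.2 ⟨hv, hne⟩)] at h'
    · intro h v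
      cases v with
      | inl w => exact AddSubgroup.mem_top _
      | inr v =>
        by_cases hv : (Sum.inr v : Place K) ∈ S ∨ v = v₀
        · rw [h𝓣'top v hv]; exact AddSubgroup.mem_top _
        · rw [h𝓣'ur v hv]; exact h v (fun h' => hv (Or.inl h')) (fun h' => hv (Or.inr h'))
  let A' : AddSubgroup (galoisCohomology (ρ.tateDual n) 1) := 𝓣'.selmerGroup
  let U : AddSubgroup (galoisCohomology ((ρ.tateDual n).toLocal (Sum.inr v₀)) 1) :=
    unramifiedSubgroup (GaloisRep.toLocal v₀ (ρ.tateDual n)) 1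
  let g : A' →+ galoisCohomology ((ρ.tateDual n).toLocal (Sum.inr v₀)) 1 ⧸ U :=
    (QuotientAddGroup.mk' U).comp
      ((galoisCohomology.localization (ρ.tateDual n) (Sum.inr v₀) 1).comp A'.subtype)
  have hg_apply : ∀ y : A', g y = QuotientAddGroup.mk' U
      (galoisCohomology.localization (ρ.tateDual n) (Sum.inr v₀) 1 y) := fun _ => rfl
  -- surjectivity of `g` (§1)
  have hg : Surjective g := by
    intro q
    obtain ⟨u₀, rfl⟩ := QuotientAddGroup.mk'_surjective U q
    obtain ⟨y, hy, hyu⟩ := exists_localization_sub_mem_unramifiedSubgroup hur hcomp ρ hM S hinf hS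
      hstab hv₀ u₀
    refine ⟨⟨y, (hmem𝓣' y).2 hy⟩, ?_⟩
    rw [hg_apply, QuotientAddGroup.mk'_apply, QuotientAddGroup.mk'_apply, QuotientAddGroup.eq_iff_sub_mem]
    exact hyu
  -- `λ` kills `ker g` (those classes are unramified off `S`)
  have hkerg : g.ker ≤ (lam.comp A'.subtype).ker := by
    intro y hy
    rw [AddMonoidHom.mem_ker, hg_apply, QuotientAddGroup.mk'_apply, QuotientAddGroup.eq_zero_iff] at hy
    rw [AddMonoidHom.mem_ker, AddMonoidHom.comp_apply, AddSubgroup.coe_subtype]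
    refine hlam _ fun v hv => ?_
    by_cases hvv : v = v₀
    · subst hvv; exact hy
    · exact (hmem𝓣' _).1 y.2 v hv hvv
  let Λq : galoisCohomology ((ρ.tateDual n).toLocal (Sum.inr v₀)) 1 ⧸ U →+ ZMod n :=
    g.liftOfSurjective hg ⟨lam.comp A'.subtype, hkerg⟩
  have hΛq : ∀ y : A', Λq (g y) = lam y := fun y =>
    AddMonoidHom.liftOfRightInverse_comp_apply g _ _ ⟨lam.comp A'.subtype, hkerg⟩ y
  let Λ : galoisCohomology ((ρ.tateDual n).toLocal (Sum.inr v₀)) 1 →+ ZMod n :=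
    Λq.comp (QuotientAddGroup.mk' U)
  -- local Tate duality at `v₀`: `Λ = ⟨t₀, ·⟩_{v₀}`
  obtain ⟨t₀, ht₀⟩ := ((hperf v₀).2 ρ hM).1.2 Λ
  refine ⟨t₀, ?_, fun y hy => ?_⟩
  · -- `t₀` annihilates `H¹_ur(K_{v₀}, M^D)`, hence is unramified (Milne I Thm. 2.6)
    refine (hur ρ hM v₀ (hS v₀ hv₀).1 (hS v₀ hv₀).2).2 t₀ fun b hb => ?_
    rw [ht₀]
    have hb0 : (QuotientAddGroup.mk' U) b = 0 := (QuotientAddGroup.eq_zero_iff _).mpr hb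
    change Λq (QuotientAddGroup.mk' U b) = 0
    rw [hb0, map_zero]
  · have hyA' : y ∈ A' := (hmem𝓣' y).2 hy
    rw [ht₀, ← hΛq ⟨y, hyA'⟩]
    rfl

end Representative

end Summit.BirchSwinnertonDyer.BirchSwinnertonDyer.Theorems.PoitouTateShaAnnihilator

end
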